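import Summits.Ventures.PercRepro2.CaseOneStarMainQtI
import Summits.Ventures.PercRepro2.CaseOneRootsAndBQ
import Summits.Ventures.PercRepro2.CaseOneDWorldLeafI
import Summits.Ventures.PercRepro2.CaseOneThickeningRel

/-!
# `(i-Q)` for the roots-and-`b` class (single edges), by a null edge to `o` (blind cell PercRepro2,
p1 g28; S5 §2.3, the `(i-Q)` entry of the row «roots + one edge to `b`» CLOSED for single edges)

«An absent edge is an edge of weight `0`» (the cell's `CaseOneNullDelete`), used here in the other
direction: the graph `G` is EXTENDED by one edge `none : Option E` with ends `s` and weight `0`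
(`extEnds`, `extW`); the configurations with the new edge open have weight `0`, the others are the
configurations of `G` (`extCfg`), and every connection event transfers (`conn_ext`, `prob_ext`), so the
Q pair and the `(i)` / `(ii)` forms of `G` and of its extension agree (`Dqo_ext`, `probQ_ext`,
`iExprT_ext`, `iiExprT_ext`; `zSplitIQ_of_ext`, `zSplitIIQ_of_ext`). A statement vertex `a₃` adjacent
to `a₁`, `a₂`, `b` through single edges becomes, after a null edge to `o`, the MARKED STAR
`a₃ ~ {a₁, a₂, o, b}`, whose `(i-Q)` and `(ii-Q)` are tree theorems for EVERY weight vector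
(`zSplitIQ_of_markedStar`, `zSplitIIQ_of_markedStar`, p1 g17–g19). Hence
**`zSplitIQ_of_rootsAndB_single`**: `(i-Q)` for `a₃ ~ {a₁, a₂, b}` (single edges), and with the
`(ii)`, `(i)`, `(ii-Q)` theorems of the class **`fourForms_of_rootsAndB_single`** /
**`closedAt_of_rootsAndB_single`** — the single-edge roots-and-`b` graph is a CLOSED graph of the
rung (all four forms, every weight vector). The variants with the edge to `a₂` or to `a₁` absent
(`zSplitIQ_of_a1b`, `zSplitIQ_of_a2b`: `a₃ ~ {a₁, b}`, `a₃ ~ {a₂, b}`) follow by a second null edge.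
Parallel root edges reduce to this by `zSplitIQ_of_merge`. Own code; standard axioms.
-/

namespace Summit.Ventures.PercRepro2

namespace CaseOne

/-! ## Extending a graph by a null edge -/

section Ext
variable {V : Type*} {E : Type*} [Fintype E] [DecidableEq E] {R : Type*} [CommRing R]

/-- The edge map of `G` extended by one edge `none` with ends `s`. -/
def extEnds (ends : E → Sym2 V) (s : Sym2 V) : Option E → Sym2 V := fun e => e.elim s ends

/-- The weights of `G` extended by a null edge. -/
def extW (p : E → R) : Option E → R := fun e => e.elim 0 p

/-- A configuration of `G`, extended by the closed new edge. -/
def extCfg (ω : Config E) : Config (Option E) := fun e => e.elim false ω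

omit [Fintype E] [DecidableEq E] in
/-- The old edges keep their ends. -/
@[simp] lemma extEnds_some (ends : E → Sym2 V) (s : Sym2 V) (e : E) :
    extEnds ends s (some e) = ends e := rfl

omit [Fintype E] [DecidableEq E] in
/-- The new edge has ends `s`. -/
@[simp] lemma extEnds_none (ends : E → Sym2 V) (s : Sym2 V) : extEnds ends s none = s := rfl

omit [Fintype E] [DecidableEq E] in
/-- The old edges keep their weights. -/
@[simp] lemma extW_some (p : E → R) (e : E) : extW p (some e) = p e := rfl

omit [Fintype E] [DecidableEq E] in
/-- The new edge is null. -/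
@[simp] lemma extW_none (p : E → R) : extW p none = 0 := rfl

omit [Fintype E] [DecidableEq E] in
/-- The old edges keep their states. -/
@[simp] lemma extCfg_some (ω : Config E) (e : E) : extCfg ω (some e) = ω e := rfl

omit [Fintype E] [DecidableEq E] in
/-- The new edge is closed. -/
@[simp] lemma extCfg_none (ω : Config E) : extCfg ω none = false := rfl

omit [Fintype E] [DecidableEq E] in
/-- Open adjacency ignores the closed new edge. -/
lemma openAdj_ext (ends : E → Sym2 V) (s : Sym2 V) (ω : Config E) (x y : V) :
    OpenAdj (extEnds ends s) (extCfg ω) x y ↔ OpenAdj ends ω x y := by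
  constructor
  · rintro ⟨e, he, h⟩
    cases e with
    | none => simp at he
    | some e => exact ⟨e, he, h⟩
  · rintro ⟨e, he, h⟩
    exact ⟨some e, he, h⟩

omit [Fintype E] [DecidableEq E] in
/-- The open subgraph ignores the closed new edge. -/
lemma openGraph_ext (ends : E → Sym2 V) (s : Sym2 V) (ω : Config E) :
    openGraph (extEnds ends s) (extCfg ω) = openGraph ends ω := by
  ext u v
  rw [openGraph_adj, openGraph_adj, openAdj_ext]

omit [Fintype E] [DecidableEq E] in
/-- Connections ignore the closed new edge. -/
lemma conn_ext (ends : E → Sym2 V) (s : Sym2 V) (ω : Config E) (x y : V) :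
    Conn (extEnds ends s) (extCfg ω) x y ↔ Conn ends ω x y := by
  unfold Conn
  rw [openGraph_ext]

omit [Fintype E] [DecidableEq E] in
/-- Membership in a connection event ignores the closed new edge. -/
lemma mem_connEvent_ext (ends : E → Sym2 V) (s : Sym2 V) (ω : Config E) (x y : V) :
    extCfg ω ∈ connEvent (extEnds ends s) x y ↔ ω ∈ connEvent ends x y := by
  simp only [mem_connEvent, conn_ext]

omit [DecidableEq E] in
/-- The weight of an extended configuration. -/
lemma weight_ext (p : E → R) (ω : Config E) : weight (extW p) (extCfg ω) = weight p ω := by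
  unfold weight
  rw [Fintype.prod_option]
  simp [edgeFactor]

omit [DecidableEq E] in
/-- A configuration with the null new edge open has weight `0`. -/
lemma weight_ext_of_open (p : E → R) (ω' : Config (Option E)) (h : ω' none = true) :
    weight (extW p) ω' = 0 := by
  unfold weight
  exact Finset.prod_eq_zero (Finset.mem_univ none) (by simp [edgeFactor, h])

omit [Fintype E] [DecidableEq E] in
/-- The extended configuration in the product coordinates. -/
lemma piOptionEquivProd_symm_false (ω : Config E) :
    (Equiv.piOptionEquivProd (β := fun _ : Option E => Bool)).symm (false, ω) = extCfg ω := by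
  funext e
  cases e <;> rfl

/-- **Probabilities across the null new edge**: if `A'` restricted to the configurations with the new
edge closed is `A`, then `P'(A') = P(A)`. -/
theorem prob_ext (p : E → R) (A : Set (Config E)) (A' : Set (Config (Option E)))
    (hA : ∀ ω : Config E, extCfg ω ∈ A' ↔ ω ∈ A) : prob (extW p) A' = prob p A := by
  unfold prob
  rw [← (Equiv.piOptionEquivProd (β := fun _ : Option E => Bool)).symm.sum_comp,
    Fintype.sum_prod_type, Fintype.sum_bool]
  have h1 : ∑ ω : Config E, A'.indicator (weight (extW p))
      ((Equiv.piOptionEquivProd (β := fun _ : Option E => Bool)).symm (true, ω)) = 0 := by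
    refine Finset.sum_eq_zero fun ω _ => ?_
    by_cases hm : (Equiv.piOptionEquivProd (β := fun _ : Option E => Bool)).symm (true, ω) ∈ A'
    · rw [Set.indicator_of_mem hm]
      exact weight_ext_of_open p _ rfl
    · rw [Set.indicator_of_notMem hm]
  rw [h1, zero_add]
  refine Finset.sum_congr rfl fun ω _ => ?_
  rw [piOptionEquivProd_symm_false]
  by_cases hm : ω ∈ A
  · rw [Set.indicator_of_mem ((hA ω).2 hm), Set.indicator_of_mem hm, weight_ext]
  · rw [Set.indicator_of_notMem (fun h => hm ((hA ω).1 h)), Set.indicator_of_notMem hm]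

/-- The Q pair across the null new edge. -/
theorem probQ_ext (p : E → R) (ends : E → Sym2 V) (s : Sym2 V) (a₁ a₂ : V) :
    prob (extW p) (connEvent (extEnds ends s) a₁ a₂)ᶜ = prob p (connEvent ends a₁ a₂)ᶜ :=
  prob_ext p _ _ fun ω => by simp only [Set.mem_compl_iff, mem_connEvent_ext]

/-- `Dqo` across the null new edge. -/
theorem Dqo_ext (p : E → R) (ends : E → Sym2 V) (s : Sym2 V) (o a₁ a₂ : V) :
    Dqo (extW p) (extEnds ends s) o a₁ a₂ = Dqo p ends o a₁ a₂ := by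
  unfold Dqo
  exact prob_ext p _ _ fun ω => by
    simp only [Set.mem_inter_iff, Set.mem_union, Set.mem_compl_iff, mem_connEvent_ext]

/-- **`iExprT` across the null new edge.** -/
theorem iExprT_ext (p : E → R) (ends : E → Sym2 V) (s : Sym2 V) (o a₁ a₂ a₃ b : V) (c₀ c₁ : R) :
    iExprT (extW p) (extEnds ends s) o a₁ a₂ a₃ b c₀ c₁ = iExprT p ends o a₁ a₂ a₃ b c₀ c₁ := by
  rw [iExprT_eq, iExprT_eq]
  have e1 := prob_ext p (connEvent ends a₁ b ∩ connEvent ends a₁ a₃ ∩ connEvent ends a₂ o ∩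
    (connEvent ends a₁ a₂)ᶜ) (connEvent (extEnds ends s) a₁ b ∩ connEvent (extEnds ends s) a₁ a₃ ∩
    connEvent (extEnds ends s) a₂ o ∩ (connEvent (extEnds ends s) a₁ a₂)ᶜ) fun ω => by
      simp only [Set.mem_inter_iff, Set.mem_compl_iff, mem_connEvent_ext]
  have e2 := prob_ext p (connEvent ends a₁ b ∩ (connEvent ends a₁ a₂)ᶜ)
    (connEvent (extEnds ends s) a₁ b ∩ (connEvent (extEnds ends s) a₁ a₂)ᶜ) fun ω => by
      simp only [Set.mem_inter_iff, Set.mem_compl_iff, mem_connEvent_ext]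
  have e3 := prob_ext p (connEvent ends a₁ a₃ ∩ connEvent ends a₂ o ∩ (connEvent ends a₁ a₂)ᶜ)
    (connEvent (extEnds ends s) a₁ a₃ ∩ connEvent (extEnds ends s) a₂ o ∩
      (connEvent (extEnds ends s) a₁ a₂)ᶜ) fun ω => by
      simp only [Set.mem_inter_iff, Set.mem_compl_iff, mem_connEvent_ext]
  have e4 := prob_ext p (connEvent ends a₁ b ∩ connEvent ends a₁ a₃ ∩ (connEvent ends a₁ a₂)ᶜ)
    (connEvent (extEnds ends s) a₁ b ∩ connEvent (extEnds ends s) a₁ a₃ ∩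
      (connEvent (extEnds ends s) a₁ a₂)ᶜ) fun ω => by
      simp only [Set.mem_inter_iff, Set.mem_compl_iff, mem_connEvent_ext]
  have e5 := prob_ext p (connEvent ends a₁ a₃ ∩ (connEvent ends a₁ a₂)ᶜ)
    (connEvent (extEnds ends s) a₁ a₃ ∩ (connEvent (extEnds ends s) a₁ a₂)ᶜ) fun ω => by
      simp only [Set.mem_inter_iff, Set.mem_compl_iff, mem_connEvent_ext]
  rw [probQ_ext, e1, e2, e3, e4, e5]

/-- **`iiExprT` across the null new edge.** -/
theorem iiExprT_ext (p : E → R) (ends : E → Sym2 V) (s : Sym2 V) (o a₁ a₂ a₃ b : V) (c₀ c₁ : R) :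
    iiExprT (extW p) (extEnds ends s) o a₁ a₂ a₃ b c₀ c₁ = iiExprT p ends o a₁ a₂ a₃ b c₀ c₁ := by
  rw [iiExprT_eq, iiExprT_eq]
  have e1 := prob_ext p (connEvent ends a₂ b ∩ connEvent ends a₁ a₃ ∩ connEvent ends a₂ o ∩
    (connEvent ends a₁ a₂)ᶜ) (connEvent (extEnds ends s) a₂ b ∩ connEvent (extEnds ends s) a₁ a₃ ∩
    connEvent (extEnds ends s) a₂ o ∩ (connEvent (extEnds ends s) a₁ a₂)ᶜ) fun ω => by
      simp only [Set.mem_inter_iff, Set.mem_compl_iff, mem_connEvent_ext]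
  have e2 := prob_ext p (connEvent ends a₂ b ∩ (connEvent ends a₁ a₂)ᶜ)
    (connEvent (extEnds ends s) a₂ b ∩ (connEvent (extEnds ends s) a₁ a₂)ᶜ) fun ω => by
      simp only [Set.mem_inter_iff, Set.mem_compl_iff, mem_connEvent_ext]
  have e3 := prob_ext p (connEvent ends a₁ a₃ ∩ connEvent ends a₂ o ∩ (connEvent ends a₁ a₂)ᶜ)
    (connEvent (extEnds ends s) a₁ a₃ ∩ connEvent (extEnds ends s) a₂ o ∩
      (connEvent (extEnds ends s) a₁ a₂)ᶜ) fun ω => by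
      simp only [Set.mem_inter_iff, Set.mem_compl_iff, mem_connEvent_ext]
  have e4 := prob_ext p (connEvent ends a₂ b ∩ connEvent ends a₁ a₃ ∩ (connEvent ends a₁ a₂)ᶜ)
    (connEvent (extEnds ends s) a₂ b ∩ connEvent (extEnds ends s) a₁ a₃ ∩
      (connEvent (extEnds ends s) a₁ a₂)ᶜ) fun ω => by
      simp only [Set.mem_inter_iff, Set.mem_compl_iff, mem_connEvent_ext]
  have e5 := prob_ext p (connEvent ends a₁ a₃ ∩ (connEvent ends a₁ a₂)ᶜ)
    (connEvent (extEnds ends s) a₁ a₃ ∩ (connEvent (extEnds ends s) a₁ a₂)ᶜ) fun ω => by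
      simp only [Set.mem_inter_iff, Set.mem_compl_iff, mem_connEvent_ext]
  rw [probQ_ext, e1, e2, e3, e4, e5]

end Ext

section ExtOrder
variable {V : Type*} {E : Type*} [Fintype E] [DecidableEq E] {R : Type*} [CommRing R]
  [LinearOrder R] [IsStrictOrderedRing R]

omit [Fintype E] [DecidableEq E] in
/-- The extended weights are admissible. -/
lemma isProbVec_extW {p : E → R} (hp : IsProbVec p) : IsProbVec (extW p) := by
  refine ⟨fun e => ?_, fun e => ?_⟩ <;> cases e
  · exact le_rfl
  · exact hp.nonneg _
  · exact zero_le_one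
  · exact hp.le_one _

omit [IsStrictOrderedRing R] in
/-- **`(i-Q)` transfers from the extension to `G`.** -/
theorem zSplitIQ_of_ext {p : E → R} {ends : E → Sym2 V} {s : Sym2 V} {o a₁ a₂ a₃ b : V}
    (h : ZSplitIQ (extW p) (extEnds ends s) o a₁ a₂ a₃ b) : ZSplitIQ p ends o a₁ a₂ a₃ b := by
  unfold ZSplitIQ at h ⊢
  rw [iExprT_ext, Dqo_ext, probQ_ext] at h
  exact h

omit [IsStrictOrderedRing R] in
/-- **`(ii-Q)` transfers from the extension to `G`.** -/
theorem zSplitIIQ_of_ext {p : E → R} {ends : E → Sym2 V} {s : Sym2 V} {o a₁ a₂ a₃ b : V}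
    (h : ZSplitIIQ (extW p) (extEnds ends s) o a₁ a₂ a₃ b) : ZSplitIIQ p ends o a₁ a₂ a₃ b := by
  unfold ZSplitIIQ at h ⊢
  rw [iiExprT_ext, Dqo_ext, probQ_ext] at h
  exact h

end ExtOrder

/-! ## The single-edge roots-and-`b` class -/

section Class
variable {V : Type*} {E : Type*} [Fintype E] [DecidableEq E] [Fintype V] [DecidableEq V]
  {R : Type*} [Field R] [LinearOrder R] [IsStrictOrderedRing R]
variable {ends : E → Sym2 V} {o a₁ a₂ a₃ b : V} {e₁ e₂ eb : E}

omit [Fintype E] [DecidableEq E] [Fintype V] [DecidableEq V] in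
/-- **The single-edge roots-and-`b` star plus a null edge to `o` is the marked star.** -/
lemma isMarkedStarAt_ext (he₁ : ends e₁ = s(a₁, a₃)) (he₂ : ends e₂ = s(a₂, a₃))
    (heb : ends eb = s(b, a₃)) (h12 : e₁ ≠ e₂) (h1b : e₁ ≠ eb) (h2b : e₂ ≠ eb)
    (hunique : ∀ e, a₃ ∈ ends e → e = e₁ ∨ e = e₂ ∨ e = eb) (h1 : a₁ ≠ a₃) (h2 : a₂ ≠ a₃)
    (ho : o ≠ a₃) (hb : b ≠ a₃) :
    IsMarkedStarAt (extEnds ends s(o, a₃)) o a₁ a₂ b a₃ (some e₁) (some e₂) none (some eb) where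
  ends_1 := by simp [he₁]
  ends_2 := by simp [he₂]
  ends_o := rfl
  ends_b := by simp [heb]
  ne_12 := by simp [h12]
  ne_1o := by simp
  ne_1b := by simp [h1b]
  ne_2o := by simp
  ne_2b := by simp [h2b]
  ne_ob := by simp
  unique := by
    intro e he
    cases e with
    | none => exact Or.inr (Or.inr (Or.inl rfl))
    | some e =>
      rcases hunique e he with h | h | h
      · exact Or.inl (by rw [h])
      · exact Or.inr (Or.inl (by rw [h]))
      · exact Or.inr (Or.inr (Or.inr (by rw [h])))
  ne_a1 := h1
  ne_a2 := h2
  ne_o := ho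
  ne_b := hb

/-- **`(i-Q)` for `a₃ ~ {a₁, a₂, b}` through single edges.** -/
theorem zSplitIQ_of_rootsAndB_single (p : E → R) (hp : IsProbVec p) (he₁ : ends e₁ = s(a₁, a₃))
    (he₂ : ends e₂ = s(a₂, a₃)) (heb : ends eb = s(b, a₃)) (h12 : e₁ ≠ e₂) (h1b : e₁ ≠ eb)
    (h2b : e₂ ≠ eb) (hunique : ∀ e, a₃ ∈ ends e → e = e₁ ∨ e = e₂ ∨ e = eb) (h1 : a₁ ≠ a₃)
    (h2 : a₂ ≠ a₃) (ho : o ≠ a₃) (hb : b ≠ a₃) : ZSplitIQ p ends o a₁ a₂ a₃ b :=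
  zSplitIQ_of_ext (zSplitIQ_of_markedStar (extW p) (isProbVec_extW hp)
    (isMarkedStarAt_ext he₁ he₂ heb h12 h1b h2b hunique h1 h2 ho hb))

/-- **`(ii-Q)` for `a₃ ~ {a₁, a₂, b}` through single edges** (a second proof, by the marked star). -/
theorem zSplitIIQ_of_rootsAndB_single (p : E → R) (hp : IsProbVec p) (he₁ : ends e₁ = s(a₁, a₃))
    (he₂ : ends e₂ = s(a₂, a₃)) (heb : ends eb = s(b, a₃)) (h12 : e₁ ≠ e₂) (h1b : e₁ ≠ eb)
    (h2b : e₂ ≠ eb) (hunique : ∀ e, a₃ ∈ ends e → e = e₁ ∨ e = e₂ ∨ e = eb) (h1 : a₁ ≠ a₃)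
    (h2 : a₂ ≠ a₃) (ho : o ≠ a₃) (hb : b ≠ a₃) : ZSplitIIQ p ends o a₁ a₂ a₃ b :=
  zSplitIIQ_of_ext (zSplitIIQ_of_markedStar (extW p) (isProbVec_extW hp)
    (isMarkedStarAt_ext he₁ he₂ heb h12 h1b h2b hunique h1 h2 ho hb))

omit [Fintype E] [DecidableEq E] [Fintype V] [DecidableEq V] in
/-- The root-edge description of the class. -/
lemma rootsAndB_hroot (he₁ : ends e₁ = s(a₁, a₃)) (he₂ : ends e₂ = s(a₂, a₃))
    (hunique : ∀ e, a₃ ∈ ends e → e = e₁ ∨ e = e₂ ∨ e = eb) :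
    ∀ e, a₃ ∈ ends e → e ≠ eb → ends e = s(a₁, a₃) ∨ ends e = s(a₂, a₃) := by
  intro e he hne
  rcases hunique e he with h | h | h
  · exact Or.inl (by rw [h, he₁])
  · exact Or.inr (by rw [h, he₂])
  · exact absurd h hne

/-- **All four forms for `a₃ ~ {a₁, a₂, b}` through single edges.** -/
theorem fourForms_of_rootsAndB_single (p : E → R) (hp : IsProbVec p) (he₁ : ends e₁ = s(a₁, a₃))
    (he₂ : ends e₂ = s(a₂, a₃)) (heb : ends eb = s(b, a₃)) (h12 : e₁ ≠ e₂) (h1b : e₁ ≠ eb)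
    (h2b : e₂ ≠ eb) (hunique : ∀ e, a₃ ∈ ends e → e = e₁ ∨ e = e₂ ∨ e = eb) (h1 : a₁ ≠ a₃)
    (h2 : a₂ ≠ a₃) (ho : o ≠ a₃) (hb : b ≠ a₃) : FourForms p ends o a₁ a₂ a₃ b :=
  ⟨zSplitII_of_rootsAndB p hp heb (rootsAndB_hroot he₁ he₂ hunique) hb h1 h2 ho,
    zSplitIIQ_of_rootsAndB p hp heb (rootsAndB_hroot he₁ he₂ hunique) hb h1 o,
    zSplitI_of_rootsAndB p hp heb (rootsAndB_hroot he₁ he₂ hunique) hb h1 h2 ho,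
    zSplitIQ_of_rootsAndB_single p hp he₁ he₂ heb h12 h1b h2b hunique h1 h2 ho hb⟩

/-- **The single-edge roots-and-`b` graph is closed** (all four forms for every weight vector). -/
theorem closedAt_of_rootsAndB_single (he₁ : ends e₁ = s(a₁, a₃)) (he₂ : ends e₂ = s(a₂, a₃))
    (heb : ends eb = s(b, a₃)) (h12 : e₁ ≠ e₂) (h1b : e₁ ≠ eb) (h2b : e₂ ≠ eb)
    (hunique : ∀ e, a₃ ∈ ends e → e = e₁ ∨ e = e₂ ∨ e = eb) (h1 : a₁ ≠ a₃) (h2 : a₂ ≠ a₃)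
    (ho : o ≠ a₃) (hb : b ≠ a₃) : ClosedAt R o a₁ a₂ b E ends a₃ :=
  fun p hp => fourForms_of_rootsAndB_single p hp he₁ he₂ heb h12 h1b h2b hunique h1 h2 ho hb

/-- **`(i-Q)` for `a₃ ~ {a₁, b}` through single edges** (no edge to `a₂`): a null edge to `a₂`, then
the single-edge class. -/
theorem zSplitIQ_of_a1b (p : E → R) (hp : IsProbVec p) (he₁ : ends e₁ = s(a₁, a₃))
    (heb : ends eb = s(b, a₃)) (h1b : e₁ ≠ eb) (hunique : ∀ e, a₃ ∈ ends e → e = e₁ ∨ e = eb)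
    (h1 : a₁ ≠ a₃) (h2 : a₂ ≠ a₃) (ho : o ≠ a₃) (hb : b ≠ a₃) : ZSplitIQ p ends o a₁ a₂ a₃ b := by
  refine zSplitIQ_of_ext (s := s(a₂, a₃)) ?_
  refine zSplitIQ_of_rootsAndB_single (extW p) (isProbVec_extW hp) (e₁ := some e₁) (e₂ := none)
    (eb := some eb) (by simp [he₁]) rfl (by simp [heb]) (by simp) (by simp [h1b]) (by simp) ?_ h1 h2
    ho hb
  intro e he
  cases e with
  | none => exact Or.inr (Or.inl rfl)
  | some e =>
    rcases hunique e he with h | h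
    · exact Or.inl (by rw [h])
    · exact Or.inr (Or.inr (by rw [h]))

/-- **`(i-Q)` for `a₃ ~ {a₂, b}` through single edges** (no edge to `a₁`): a null edge to `a₁`, then
the single-edge class. -/
theorem zSplitIQ_of_a2b (p : E → R) (hp : IsProbVec p) (he₂ : ends e₂ = s(a₂, a₃))
    (heb : ends eb = s(b, a₃)) (h2b : e₂ ≠ eb) (hunique : ∀ e, a₃ ∈ ends e → e = e₂ ∨ e = eb)
    (h1 : a₁ ≠ a₃) (h2 : a₂ ≠ a₃) (ho : o ≠ a₃) (hb : b ≠ a₃) : ZSplitIQ p ends o a₁ a₂ a₃ b := by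
  refine zSplitIQ_of_ext (s := s(a₁, a₃)) ?_
  refine zSplitIQ_of_rootsAndB_single (extW p) (isProbVec_extW hp) (e₁ := none) (e₂ := some e₂)
    (eb := some eb) rfl (by simp [he₂]) (by simp [heb]) (by simp) (by simp) (by simp [h2b]) ?_ h1 h2
    ho hb
  intro e he
  cases e with
  | none => exact Or.inl rfl
  | some e =>
    rcases hunique e he with h | h
    · exact Or.inr (Or.inl (by rw [h]))
    · exact Or.inr (Or.inr (by rw [h]))

end Class

end CaseOne

end Summit.Ventures.PercRepro2
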